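import Summits.QuantumFields.YangMills.Theorems.UnitScaleTiltProp7FlatBlockInverseEstimate
import Summits.QuantumFields.YangMills.Theorems.UnitScaleTiltProp7FlatCutoffCaccioppoli
import HarnessLib

/-!
# Route `UnitScaleTilt`, crux K1 «MinimiserStabilityRegPr» (stmt-QuantumFields-19200), route-R E′ S3 ∕ line «HKGK-ANALYTIC», row (R-loc) — THE ASSEMBLY:
# THE FLAT LOCAL BERNSTEIN INEQUALITY `Σ_μ' Σ_x χ(x)²·(A_μ(x+e_μ') − A_μ(x))² ≤ ℓ⁻²·(C·Σ_{blocks} A_μ² + 8d·Σ_{S₁} A_μ²)` for a local solution of `Δ A_μ = ((Q_k)ᵀν)_μ`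
# on a union of `k`-blocks, under a block-Lipschitz cutoff `χ` (`|χ| ≤ 1`, `|χ(x+e) − χ(x)| ≤ ℓ⁻¹`, supported in the blocks) — ✓p684843 `sum_sq_mul_sq_diff_le_sourced` at `t = ℓ²`
# plus ✓`Prop7FlatBlockInverseEstimate.sum_block_sq_transpose_le` on every block (this seat's LOCATE-RLOC 7deca12a §3; ★w4-19200 g7 LOCATE v2 (R-loc), «BRICK 2 GO»)

Cell `ym3-torus`, twin-width seat `ym-ust-19936-w8` (gen 5).  THEOREMS ONLY (0 `def`, 0 `sorry`); `--supports stmt-QuantumFields-19200 --as helper`, count-neutral.  YM₃ on T³ is a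
ladder rung (R3), not the Clay problem; nothing here claims S3, hKg-K, ℛ-ROW★, J-ROW★, E′, the stub, the crux, d = 4 or the mass gap.

WHAT IS PROVED (ns `…Theorems.Prop7FlatLocalBernstein`; `k ≤ m + K`, `4 ≤ L^k`, `ℓ = (L:ℝ)^k`; `Ω : Finset (Site P k)` the blocks of the region, `U = ⋃_{y∈Ω} B^k(y)`; cutoff `χ`
with `|χ| ≤ 1`, `χ = 0` off `U`, `(χ(x+e_μ') − χ(x))² ≤ ℓ⁻²`, and a finset `S₁` containing both ends of every bond where `χ` changes).
* §1 `sum_sq_mul_le_sum_biUnion` (`Σ_x χ²g ≤ Σ_U g` for `g ≥ 0`), `sum_biUnion_blocks` (`Σ_U = Σ_{y∈Ω} Σ_{B^k(y)}`), `sum_shift_sq_le` (the shifted mass over the change set is `≤ Σ_{S₁}`).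
* §2 ★★★ `local_bernstein` — `Σ_{μ'} Σ_x χ(x)²(A⟨x+e_μ',μ⟩ − A⟨x,μ⟩)² ≤ (2·C(d,ℓ)·ℓ² + 2∕ℓ²)·Σ_{y∈Ω}Σ_{x∈B^k(y)} A⟨x,μ⟩² + (8d∕ℓ²)·Σ_{x∈S₁} A⟨x,μ⟩²`, `C(d,ℓ) = C_d·ℓ⁻⁴` the
  raw constant of ✓`sum_block_sq_transpose_le` — every term `ℓ⁻²·(local mass)`, constants absolute; hypotheses ONLY the local equation on the blocks of `Ω` and the cutoff geometry
  (no co-closedness, no mean condition, no periodisation, no boundary layer).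
HONEST SCOPE.  Flat, linear; [folklore] Caccioppoli + the blockwise inverse estimate; the choice of `χ`, `Ω`, `S₁` for a concrete box is the consumer's (e.g. `χ` = 1 on `Ω₀`-blocks,
linear ramp over one block layer); nothing curved; nothing of Bałaban's estimates is asserted.

References: T. Bałaban, CMP 95 (1984) 17–40 [Balaban1984PropagatorsI] ((1.18) p.20, (1.21) p.21, Sect. C p.22); CMP 99 (1985) 389–434 [Balaban1985BackgroundPropagators] (Thm 3.11 p.416);
M. Giaquinta, Princeton UP 1983 [Giaquinta1984] (Ch. III §2 (2.3)–(2.4) p.77).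
-/

set_option autoImplicit false

noncomputable section

open scoped BigOperators

namespace Summit.QuantumFields.YangMills.Theorems.Prop7FlatLocalBernstein

open Literature.MathematicalPhysics.QuantumFieldTheory.Balaban1983to89
open Finset LatticeFieldCalculus
open B5Eq118OneStroke (iterBlock pairwiseDisjoint_iterBlock)
open Summit.QuantumFields.YangMills.Theorems.Prop7FlatBlockInverseEstimate (sum_block_sq_transpose_le)
open Summit.QuantumFields.YangMills.Theorems.Prop7FlatCutoffCaccioppoli (sum_sq_mul_sq_diff_le_sourced)

variable {P : Params} {k j : ℕ}

/-! ## §1 Support bookkeeping -/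

/-- `Σ_x χ(x)²g(x) ≤ Σ_{x∈U} g(x)` for `g ≥ 0`, `|χ| ≤ 1`, `χ = 0` off `U`. [folklore] -/
theorem sum_sq_mul_le_sum_of_support (χ g : SiteField P j ℝ) (U : Finset (Site P j)) (hg : ∀ x, 0 ≤ g x) (hχ1 : ∀ x, |χ x| ≤ 1)
    (hχU : ∀ x, χ x ≠ 0 → x ∈ U) : ∑ x : Site P j, χ x ^ 2 * g x ≤ ∑ x ∈ U, g x := by
  classical
  have h1 : ∑ x : Site P j, χ x ^ 2 * g x = ∑ x ∈ U, χ x ^ 2 * g x := by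
    rw [← Finset.sum_subset (Finset.subset_univ U)]
    intro x _ hx
    have : χ x = 0 := by by_contra h; exact hx (hχU x h)
    rw [this]; ring
  rw [h1]
  refine Finset.sum_le_sum fun x _ => ?_
  have hχ2 : χ x ^ 2 ≤ 1 := by
    have := hχ1 x
    rw [← sq_abs]; nlinarith [abs_nonneg (χ x)]
  nlinarith [hg x]

/-- `Σ_{x ∈ ⋃_{y∈Ω} B^k(y)} g = Σ_{y∈Ω} Σ_{x∈B^k(y)} g` (distinct coarse sites have disjoint blocks). [cite: Balaban1984PropagatorsI, (1.18) p.20] -/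
theorem sum_biUnion_blocks (Ω : Finset (Site P k)) (g : Site P 0 → ℝ) :
    ∑ x ∈ Ω.biUnion (iterBlock k), g x = ∑ y ∈ Ω, ∑ x ∈ iterBlock k y, g x := by
  classical
  exact Finset.sum_biUnion (pairwiseDisjoint_iterBlock k _)

/-- The mass at BOTH ends of the bonds where `χ` changes is controlled by the mass on `S₁`. [folklore] -/
theorem sum_change_le (χ u : SiteField P j ℝ) (μ' : Fin P.d) (S₁ : Finset (Site P j)) {c : ℝ} (hc : 0 ≤ c)
    (hχlip : ∀ x, (χ (x.shift μ') - χ x) ^ 2 ≤ c) (hS₁ : ∀ x, χ (x.shift μ') ≠ χ x → x ∈ S₁ ∧ x.shift μ' ∈ S₁) :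
    ∑ x : Site P j, (χ (x.shift μ') - χ x) ^ 2 * (u x + u (x.shift μ')) ^ 2 ≤ c * (4 * ∑ x ∈ S₁, u x ^ 2) := by
  classical
  -- restrict to the change set
  set T : Finset (Site P j) := Finset.univ.filter (fun x => χ (x.shift μ') ≠ χ x) with hT
  have h1 : ∑ x : Site P j, (χ (x.shift μ') - χ x) ^ 2 * (u x + u (x.shift μ')) ^ 2
      = ∑ x ∈ T, (χ (x.shift μ') - χ x) ^ 2 * (u x + u (x.shift μ')) ^ 2 := by
    rw [← Finset.sum_subset (Finset.subset_univ T)]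
    intro x _ hx
    have : χ (x.shift μ') = χ x := by
      by_contra h; exact hx (Finset.mem_filter.mpr ⟨Finset.mem_univ x, h⟩)
    rw [this]; ring
  rw [h1]
  have h2 : ∑ x ∈ T, (χ (x.shift μ') - χ x) ^ 2 * (u x + u (x.shift μ')) ^ 2 ≤ ∑ x ∈ T, c * (2 * u x ^ 2 + 2 * u (x.shift μ') ^ 2) := by
    refine Finset.sum_le_sum fun x _ => ?_
    have hsq : (u x + u (x.shift μ')) ^ 2 ≤ 2 * u x ^ 2 + 2 * u (x.shift μ') ^ 2 := by nlinarith [sq_nonneg (u x - u (x.shift μ'))]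
    exact mul_le_mul (hχlip x) hsq (sq_nonneg _) hc
  refine h2.trans ?_
  rw [← Finset.mul_sum]
  refine mul_le_mul_of_nonneg_left ?_ hc
  rw [Finset.sum_add_distrib, ← Finset.mul_sum, ← Finset.mul_sum]
  have hTS : T ⊆ S₁ := fun x hx => (hS₁ x (Finset.mem_filter.mp hx).2).1
  have h3 : ∑ x ∈ T, u x ^ 2 ≤ ∑ x ∈ S₁, u x ^ 2 := Finset.sum_le_sum_of_subset_of_nonneg hTS (fun x _ _ => sq_nonneg _)
  -- the shifted end: inject `T` into `S₁` by `x ↦ x + e_μ'`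
  have h4 : ∑ x ∈ T, u (x.shift μ') ^ 2 ≤ ∑ x ∈ S₁, u x ^ 2 := by
    rw [← Finset.sum_image (f := fun x => u x ^ 2) (s := T) (g := fun x => x.shift μ')
      (fun x _ x' _ h => (shiftEquiv (P := P) (j := j) μ').injective h)]
    refine Finset.sum_le_sum_of_subset_of_nonneg ?_ (fun x _ _ => sq_nonneg _)
    intro z hz
    obtain ⟨x, hx, rfl⟩ := Finset.mem_image.mp hz
    exact (hS₁ x (Finset.mem_filter.mp hx).2).2
  linarith

/-! ## §2 The local Bernstein inequality -/

/-- ★★★ **THE FLAT LOCAL BERNSTEIN INEQUALITY** (R-loc): `f` the `Q_k`-transpose of ANY coarse weight `ν` (pairing `hf`), `Δ(A ·,μ) = f(·,μ)` on every block of `Ω`, `χ` a cutoff with `|χ| ≤ 1`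
supported in `U = ⋃_{y∈Ω}B^k(y)` with `(χ(x+e_μ') − χ(x))² ≤ ℓ⁻²`, `S₁` containing both ends of the bonds where `χ` changes.  THEN
`Σ_{μ'} Σ_x χ(x)²(A⟨x+e_μ',μ⟩ − A⟨x,μ⟩)² ≤ (2·C(d,ℓ)·ℓ² + 2∕ℓ²)·Σ_{y∈Ω}Σ_{x∈B^k(y)} A⟨x,μ⟩² + (8d∕ℓ²)·Σ_{x∈S₁} A⟨x,μ⟩²` — with `C(d,ℓ) = C_d·ℓ⁻⁴` the blockwise constant, every term is
`ℓ⁻²·(local mass)`: the curl-minimal interpolant is block-smooth LOCALLY, with no global object. [cite: Balaban1984PropagatorsI, (1.18) p.20, (1.21) p.21, Sect. C p.22;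
Balaban1985BackgroundPropagators, Thm 3.11 p.416; Giaquinta1984, Ch. III §2 (2.3)-(2.4) p.77] -/
theorem local_bernstein (hk : k ≤ P.m + P.K) (hℓ4 : 4 ≤ P.L ^ k) (ν : PBond P k → ℝ) (A f : PBond P 0 → ℝ)
    (hf : ∀ Y : PBond P 0 → ℝ, ∑ c : PBond P k, ν c * bondAvgIter k Y c = ∑ b : PBond P 0, f b * Y b)
    (μ : Fin P.d) (Ω : Finset (Site P k))
    (hLap : ∀ y ∈ Ω, ∀ x ∈ iterBlock k y, laplace 1 (fun z => A ⟨z, μ⟩) x = f ⟨x, μ⟩)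
    (χ : SiteField P 0 ℝ) (hχ1 : ∀ x, |χ x| ≤ 1) (hχU : ∀ x, χ x ≠ 0 → x ∈ Ω.biUnion (iterBlock k))
    (hχlip : ∀ x (μ' : Fin P.d), (χ (x.shift μ') - χ x) ^ 2 ≤ 1 / (((P.L : ℝ) ^ k) ^ 2))
    (S₁ : Finset (Site P 0)) (hS₁ : ∀ x (μ' : Fin P.d), χ (x.shift μ') ≠ χ x → x ∈ S₁ ∧ x.shift μ' ∈ S₁) :
    ∑ μ' : Fin P.d, ∑ x : Site P 0, χ x ^ 2 * (A ⟨x.shift μ', μ⟩ - A ⟨x, μ⟩) ^ 2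
      ≤ (2 * (2 * ((P.L : ℝ) ^ k) ^ P.d *
          (((P.L : ℝ) ^ k) ^ P.d * ((P.d : ℝ) * (2 * ((P.L : ℝ) ^ k) ^ 2 * ((((P.L : ℝ) ^ k) ^ 4 / 16) ^ (P.d - 1)))) ^ 2
              * (243 / ((P.L : ℝ) ^ k) ^ 5) ^ (2 * P.d)
            + ((P.L : ℝ) ^ k) ^ 2 * ((P.L : ℝ) ^ k) ^ P.d * ((P.d : ℝ) * (18 * ((P.L : ℝ) ^ k) ^ 3 * ((((P.L : ℝ) ^ k) ^ 4 / 16) ^ (P.d - 1)))) ^ 2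
              * (243 / ((P.L : ℝ) ^ k) ^ 5) ^ (2 * (P.d - 1)) * (2048 / ((P.L : ℝ) ^ k) ^ 7) ^ 2)) * ((P.L : ℝ) ^ k) ^ 2
          + 2 / ((P.L : ℝ) ^ k) ^ 2) * ∑ y ∈ Ω, ∑ x ∈ iterBlock k y, A ⟨x, μ⟩ ^ 2
        + (8 * P.d / ((P.L : ℝ) ^ k) ^ 2) * ∑ x ∈ S₁, A ⟨x, μ⟩ ^ 2 := by
  classical
  set L : ℝ := (P.L : ℝ) ^ k with hLdef
  have hL4 : (4 : ℝ) ≤ L := by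
    have : ((P.L ^ k : ℕ) : ℝ) = L := by rw [hLdef]; push_cast; rfl
    rw [← this]; exact_mod_cast hℓ4
  have hLpos : 0 < L := by linarith only [hL4]
  set C : ℝ := 2 * L ^ P.d * (L ^ P.d * ((P.d : ℝ) * (2 * L ^ 2 * ((L ^ 4 / 16) ^ (P.d - 1)))) ^ 2 * (243 / L ^ 5) ^ (2 * P.d)
      + L ^ 2 * L ^ P.d * ((P.d : ℝ) * (18 * L ^ 3 * ((L ^ 4 / 16) ^ (P.d - 1)))) ^ 2 * (243 / L ^ 5) ^ (2 * (P.d - 1)) * (2048 / L ^ 7) ^ 2) with hCdef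
  have hC0 : 0 ≤ C := by positivity
  -- the sourced Caccioppoli at scale `t = ℓ²`
  have hΔ : ∀ x : Site P 0, χ x ≠ 0 → laplace 1 (fun z => A ⟨z, μ⟩) x = (fun z => f ⟨z, μ⟩) x := by
    intro x hx
    obtain ⟨y, hy, hxy⟩ := Finset.mem_biUnion.mp (hχU x hx)
    exact hLap y hy x hxy
  have hcac := sum_sq_mul_sq_diff_le_sourced χ (fun z => A ⟨z, μ⟩) (fun z => f ⟨z, μ⟩) hΔ (t := L ^ 2) (by positivity)
  -- the three terms
  set M : ℝ := ∑ y ∈ Ω, ∑ x ∈ iterBlock k y, A ⟨x, μ⟩ ^ 2 with hMdef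
  have hT1 : ∑ x : Site P 0, χ x ^ 2 * (fun z => f ⟨z, μ⟩) x ^ 2 ≤ C * M := by
    have h1 := sum_sq_mul_le_sum_of_support χ (fun z => f ⟨z, μ⟩ ^ 2) (Ω.biUnion (iterBlock k)) (fun x => sq_nonneg _) hχ1 hχU
    refine h1.trans ?_
    rw [sum_biUnion_blocks, hMdef, Finset.mul_sum]
    refine Finset.sum_le_sum fun y hy => ?_
    have := sum_block_sq_transpose_le hk hℓ4 ν A f hf y μ (hLap y hy)
    rw [← hLdef] at this
    exact this
  have hT2 : ∑ x : Site P 0, χ x ^ 2 * (fun z => A ⟨z, μ⟩) x ^ 2 ≤ M := by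
    have h1 := sum_sq_mul_le_sum_of_support χ (fun z => A ⟨z, μ⟩ ^ 2) (Ω.biUnion (iterBlock k)) (fun x => sq_nonneg _) hχ1 hχU
    refine h1.trans (le_of_eq ?_)
    rw [sum_biUnion_blocks]
  have hT3 : ∑ μ' : Fin P.d, ∑ x : Site P 0, (χ (x.shift μ') - χ x) ^ 2 * ((fun z => A ⟨z, μ⟩) x + (fun z => A ⟨z, μ⟩) (x.shift μ')) ^ 2
      ≤ (P.d : ℝ) * (1 / L ^ 2 * (4 * ∑ x ∈ S₁, A ⟨x, μ⟩ ^ 2)) := by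
    calc _ ≤ ∑ _μ' : Fin P.d, 1 / L ^ 2 * (4 * ∑ x ∈ S₁, A ⟨x, μ⟩ ^ 2) :=
          Finset.sum_le_sum fun μ' _ => sum_change_le χ (fun z => A ⟨z, μ⟩) μ' S₁ (by positivity) (fun x => hχlip x μ') (fun x => hS₁ x μ')
      _ = (P.d : ℝ) * (1 / L ^ 2 * (4 * ∑ x ∈ S₁, A ⟨x, μ⟩ ^ 2)) := by rw [Finset.sum_const, Finset.card_univ, Fintype.card_fin, nsmul_eq_mul]
  have hM0 : 0 ≤ M := Finset.sum_nonneg fun y _ => Finset.sum_nonneg fun x _ => sq_nonneg _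
  have hS0 : 0 ≤ ∑ x ∈ S₁, A ⟨x, μ⟩ ^ 2 := Finset.sum_nonneg fun x _ => sq_nonneg _
  have hL2 : 0 < L ^ 2 := by positivity
  -- combine
  have key : ∑ μ' : Fin P.d, ∑ x : Site P 0, χ x ^ 2 * ((fun z => A ⟨z, μ⟩) (x.shift μ') - (fun z => A ⟨z, μ⟩) x) ^ 2
      ≤ 2 * L ^ 2 * (C * M) + 2 / L ^ 2 * M + 2 * ((P.d : ℝ) * (1 / L ^ 2 * (4 * ∑ x ∈ S₁, A ⟨x, μ⟩ ^ 2))) := by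
    have e1 : 2 * L ^ 2 * ∑ x : Site P 0, χ x ^ 2 * (fun z => f ⟨z, μ⟩) x ^ 2 ≤ 2 * L ^ 2 * (C * M) := mul_le_mul_of_nonneg_left hT1 (by positivity)
    have e2 : 2 / L ^ 2 * ∑ x : Site P 0, χ x ^ 2 * (fun z => A ⟨z, μ⟩) x ^ 2 ≤ 2 / L ^ 2 * M := mul_le_mul_of_nonneg_left hT2 (by positivity)
    linarith only [hcac, e1, e2, hT3]
  refine key.trans (le_of_eq ?_)
  rw [hCdef, hMdef]
  field_simp
  ring

end Summit.QuantumFields.YangMills.Theorems.Prop7FlatLocalBernstein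

end
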